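import Literature.IUT.HodgeArakelov.PlusMinusTowerCoverModelAPI
import Literature.IUT.HodgeArakelov.EtaleThetaDataOfSettingCuspidalGeneratorsTower
import HarnessLib

/-!
# [IUTchII] Def. 2.3 (ii) at the genuine `±`-tower: NO member of the tempered cusp family of `X̲_v` lies in `Π_v` — the
# level-`Π_v` family of a CONTAINMENT-keyed cuspidal datum is EMPTY (kernel certificate, proof-only, 0 definitions)

S. Mochizuki, *Inter-universal Teichmüller theory II*, kurims manuscript (Dec. 2020), §2, Def. 2.3 (i)(ii) pp. 67–68 («the
cuspidal inertia groups of `Π_⊆` may be obtained as the intersections with `Π_⊆` of those cuspidal inertia groups of `Π_⊇` that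
contain a finite index subgroup that lies inside `Π_⊆`»), Rmk. 2.3.1 p. 69 («`I ∩ Π_⊆ = I^l`»), Cor. 2.5 (i) p. 71
[claim: Mochizuki2012, status: disputed] (IUTchII §2 Def 2.3 (ii), kurims p.68); S. Mochizuki, *The étale theta function …*,
Publ. RIMS **45** (2009) [EtTh], §2 p. 35 («maps the inertia group `I_x` … onto `Δ_Θ`»), Def. 2.5 (i) p. 39 / Prop. 2.12 (i) p. 45
(«`Ker(Δ^Θ_* ↠ Δ^ell_*) = l·Δ_Θ`» for `X̲̲`) [cite: MochizukiEtTh2009, Def 2.5 (i) p.39]. abc-iut cell, layer L6, nodes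
**IUTchII:Def2.3(ii)** / **IUTchII:Cor2.5(i)** (residual J1, GAP-LEDGER G-w4d005g4-1); seat abc-iut-w4-d005 (gen 6), kernel form of
the FAITHFULNESS NOTE of 2026-08-26T11:34Z (STATUS); sequel BY NAME to `EtaleThetaDataOfSettingCuspidalGeneratorsTower.lean`
(p440613) §4 and to abc-iut-L6-t19's `PlusMinusTowerCoverModelAPI` (`piV_ofCoverModel`, `piPM_ofCoverModel`).

THE POINT. abc-iut-w5-d132's TEMPERED cuspidal datum of the genuine tower (`PlusMinusTower.exists_stableCurveAgreement_ofCoverModel`,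
p430433) declares cuspidal, AT EVERY LEVEL `Π_□`, «`J ≤ Π_□ ∧ J = t · ι((g · inclX I_x · g⁻¹) ∩ inclX Π^tp_{X̲}) · t⁻¹`» (`x` a cusp of
`X`, `g ∈ Π^tp_C`, `t ∈ Π^±_v`): the FULL cusp inertia groups of `X̲_v`, filtered by CONTAINMENT — its own HONEST LABEL (2) says so.
Print's Def. 2.3 (ii) instead takes INTERSECTIONS `I ∩ Π_⊆ = I^l` at the smaller levels. HERE, with NO appeal to expectation:

* §1 **`PlusMinusTower.not_cuspFamily_le_piV_ofCoverModel`** — at `W := ofCoverModel …` NO member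
  `t · ι((g · inclX I_x · g⁻¹) ∩ inclX Π^tp_{X̲}) · t⁻¹` (`t ∈ Π^±_v`) is contained in `Π_v = ι(inclX Π^tp_{X̲̲})`, GRANTED four named
  print-level inputs on the [EtTh] side: (h1) «`toTheta(I_x) = Δ_Θ`» for every cusp `x` ([EtTh] §2 p. 35; ⟸ the commutator-axis clause
  G-L2t10-3 by abc-iut-w5-d165's `ThetaSetting.map_toTheta_inertia_eq_deltaTheta_of_commutatorAxis`), (h2) «`I_x ⊆ Π^tp_{X̲}`» (the cusp
  inertia lies in `Π^tp_Y ⊆ Π^tp_{X̲}`: `Y → X` is étale at the cusp; the interface `TemperedCurve` does not record it), (h3) «`Π^tp_C`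
  permutes the cusp inertia groups of `Π^tp_X`» (cuspidal absoluteness for the outer `±`-automorphism, [SemiAnbd] Thm. 6.5 (iii) /
  F-1704 class; trivial on the coset `inclX(Π^tp_X)`), (h4) «`l·Δ_Θ ≠ Δ_Θ`» (non-degeneracy: `Δ_Θ ≅ Ẑ(1)`, `l ≥ 2`). Proof: `ι` and
  `inclX` are injective and `Π^tp_{X̲̲} ⊴ Π^tp_{X̲}` (hN), so containment in `Π_v` pulls back to «a `Π^tp_X`-conjugate of a cusp inertia
  group lies in `Π^tp_{X̲̲}`», whence `Δ_Θ = toTheta(γ I_{x'} γ⁻¹) ⊆ toTheta(Π^tp_{X̲̲}) ∩ Δ_Θ = l·Δ_Θ` (abc-iut-L2-t8's field `map_toTheta_Huu`),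
  contradicting (h4);
* §2 **`isEmpty_cuspidalInertia_piV_of_containment`** — hence for EVERY `Cu : CuspidalInertiaData (ofCoverModel …)` with p430433's
  characterisation (taken VERBATIM as the hypothesis `hchar`) the type `{J // Cu.IsCuspidalInertia W.piV J}` is EMPTY, and
  `forall_cuspidalInertia_piV_of_containment` — every statement «`∀ J, Cu.IsCuspidalInertia W.piV J → P J`» holds VACUOUSLY;
* §3 **`not_hgen_frame_ofCoverModel_of_containment`** — and the GAP row G-w4d005g4-1's shape for Cor. 2.5 (i) FAILS for such a `Cu`
  at the genuine Prop. 1.4 output (p440613 `not_hgen_frame_of_isEmpty`), whereas it HOLDS for the intersection-keyed datum of p440613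
  §2/§3 — the kernel form of «vacuously-true ≠ covered; the datum matters».

POSITIVE COUNTERPART (not restated here): for the INTERSECTION-keyed datum of abc-iut-w5-d132's p433029 / p434636 («`I ≤ Π_□ ∧ ∃ I₀`
cuspidal in `Π^±_v`, `I = I₀ ∩ Π_□`» — print's rule), abc-iut-L6-t19's `PlusMinusTower.isCuspidalInertia_piV_iff_cuspsXuu` (p440804,
B15b) gives the level-`Π_v` dictionary «cuspidal in `Π_v` ⟺ `eV(I) = toHat(s · I_y · s⁻¹)`, `y` a cusp of `X̲̲_v`», i.e. the family
`{Π^tp_{X̲̲} ∩ k I_x k⁻¹}` — the same family as the datum of p440613 §2 — so the two print-faithful routes agree and the containment-keyed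
data are the odd ones out at the levels below `Π^±_v`.

HONEST LIMITS: (h1)–(h4) are HYPOTHESES (named print-level inputs; none is a new `Prop` definition); nothing here edits or contradicts
p430433 (its agreement reads the level `Π^±_v`, where the family is non-empty and print-correct) — it certifies what its honest label
says about the OTHER levels; no new `def`, no instance; nothing of [EtTh] or of the series is asserted; no side is taken on
[IUTchIII] Cor. 3.12; typed ≠ proved.
-/

noncomputable section

namespace Literature.IUT.HodgeArakelov

open Literature.AnabelianGeometry.EtaleTheta Literature.AnabelianGeometry.SemiGraphs
open scoped Pointwise

/-! ### 0. Bookkeeping -/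

section Conj

variable {G G' : Type*} [Group G] [Group G']

/-- Conjugates of a subgroup of a normal subgroup stay inside it. [folklore] -/
private theorem conj_smul_le_of_le_normal {K N : Subgroup G} [hN : N.Normal] (hK : K ≤ N) (γ : G) :
    MulAut.conj γ • K ≤ N := by
  intro y hy
  rw [Subgroup.mem_smul_pointwise_iff_exists] at hy
  obtain ⟨s, hs, rfl⟩ := hy
  exact hN.conj_mem s (hK hs) γ

end Conj

namespace PlusMinusTower

variable {p : ℕ} [Fact p.Prime] {M : MuTwoSetting p} (e : M.CLevelData)
  {E : M.toThetaSetting.EtaleThetaData} {l : ℕ} (C : E.DoubleUnderline l) {N : ℕ+}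
  (μ : M.toThetaSetting.CyclotomeMod l N) (hC : M.toThetaSetting.Compat) (hS : M.toThetaSetting.Sec2Hyps)
  (hl : l.Prime) (hp2 : p ≠ 2) (hpl : p ≠ l) (hζ : ∃ ζ : M.toThetaSetting.K, IsPrimitiveRoot ζ (4 * l))
  {η : (C.thetaEnvData μ hC hS).PiYdd → MuN p N} (hη : η ∈ (C.thetaEnvData μ hC hS).thetaCocycles)
  {Q : Type} [Group Q] [TopologicalSpace Q] [IsTopologicalGroup Q]
  (ι : M.GtpC →ₜ* Q) (hι : IsProfiniteCompletion ι) (hinj : Function.Injective ι)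
  (Φ : Q →* GQp p) (hΦ : ∀ g : M.GtpC, Φ (ι g) = e.augC g) (hΦK : Φ.range = M.GK)
  (hZ : Thm16Sub.KerToZIsCompactlyGenerated M.toThetaSetting) (hN : (C.Huu.subgroupOf (M.GtpXu l)).Normal)
  {P : TopGroup.{0}} (T : TemperedCoverings (BadPlaceSetting.ofUnderline C μ hC hS hl hp2 hpl hζ hη) P)

/-! ### 1. No member of the tempered cusp family lies in `Π_v` -/

include hN in
/-- `Π^tp_{X̲̲} ⊴ Π^tp_{X̲}` (hN) in the form used below: if `u ∈ Π^tp_{X̲}` and `u s u⁻¹ ∈ Π^tp_{X̲̲}` then `s ∈ Π^tp_{X̲̲}`.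
[cite: MochizukiEtTh2009, Def 2.5 (i) p.39] -/
theorem mem_Huu_of_conj_mem {s u : M.PiTemp} (hu : u ∈ M.GtpXu l) (h : u * s * u⁻¹ ∈ C.Huu) : s ∈ C.Huu := by
  have key := hN.conj_mem ⟨u * s * u⁻¹, C.Huu_le_GtpXu h⟩ (by exact h) ⟨u⁻¹, inv_mem hu⟩
  have : (u⁻¹ * (u * s * u⁻¹) * u⁻¹⁻¹ : M.PiTemp) = s := by group
  have key' : (u⁻¹ * (u * s * u⁻¹) * u⁻¹⁻¹ : M.PiTemp) ∈ C.Huu := key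
  rwa [this] at key'

include hN in
/-- **No member of the tempered cusp family of `X̲_v` lies in `Π_v`.** At the genuine tower `W := ofCoverModel …`
(`Π_v = ι(inclX Π^tp_{X̲̲})`, `Π^±_v = ι(inclX Π^tp_{X̲})`, abc-iut-L6-t19 `piV_ofCoverModel` / `piPM_ofCoverModel`), for every cusp `x`
of `X`, every `g ∈ Π^tp_C` and every `t ∈ Π^±_v`, the group `t · ι((g · inclX I_x · g⁻¹) ∩ inclX Π^tp_{X̲}) · t⁻¹` — a member of
abc-iut-w5-d132's tempered cusp family (p430433) — is NOT contained in `Π_v`, GRANTED (h1) «`toTheta(I_x) = Δ_Θ`» at every cusp,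
(h2) «`I_x ⊆ Π^tp_{X̲}`» at every cusp, (h3) «`Π^tp_C` permutes the cusp inertia groups of `Π^tp_X`», (h4) «`l·Δ_Θ ≠ Δ_Θ`».  Print: the
cuspidal inertia groups of `Π_v` are the INTERSECTIONS `I ∩ Π_v = I^l` (Def. 2.3 (ii), Rmk. 2.3.1), not members of this family.
[claim: Mochizuki2012, status: disputed] (IUTchII §2 Def 2.3 (ii), kurims p.68) -/
theorem not_cuspFamily_le_piV_ofCoverModel
    (h1 : ∀ x : M.Pt, M.IsCusp x →
      (M.toTemperedCurve.inertia x).map M.toThetaSetting.toTheta = M.toThetaSetting.DeltaTheta)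
    (h2 : ∀ x : M.Pt, M.IsCusp x → M.toTemperedCurve.inertia x ≤ M.GtpXu l)
    (h3 : ∀ (g : M.GtpC) (x : M.Pt), M.IsCusp x → ∃ x' : M.Pt, M.IsCusp x' ∧ ∃ γ : M.PiTemp,
      MulAut.conj g • (M.toTemperedCurve.inertia x).map M.inclX =
        (MulAut.conj γ • M.toTemperedCurve.inertia x').map M.inclX)
    (h4 : M.toThetaSetting.lDeltaTheta l ≠ M.toThetaSetting.DeltaTheta)
    {x : M.Pt} (hx : M.IsCusp x) (g : M.GtpC) {t : (ofCoverModel e C μ hC hS hl hp2 hpl hζ hη ι hι hinj Φ hΦ hΦK hZ hN T).Corhat}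
    (ht : t ∈ (ofCoverModel e C μ hC hS hl hp2 hpl hζ hη ι hι hinj Φ hΦ hΦK hZ hN T).piPM) :
    ¬ (MulAut.conj t •
          (((MulAut.conj g • (M.toTemperedCurve.inertia x).map M.inclX) ⊓ (M.GtpXu l).map M.inclX).map ι.toMonoidHom :
            Subgroup (ofCoverModel e C μ hC hS hl hp2 hpl hζ hη ι hι hinj Φ hΦ hΦK hZ hN T).Corhat) ≤
        (ofCoverModel e C μ hC hS hl hp2 hpl hζ hη ι hι hinj Φ hΦ hΦK hZ hN T).piV) := by
  intro hle
  -- `t = ι(inclX t₀)`, `t₀ ∈ Π^tp_{X̲}`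
  rw [piPM_ofCoverModel] at ht
  obtain ⟨_, ⟨t₀, ht₀, rfl⟩, rfl⟩ := ht
  -- `g · inclX I_x · g⁻¹ = inclX(γ I_{x'} γ⁻¹)` (h3), and it lies in `inclX Π^tp_{X̲}` (h2 + normality of `Π^tp_{X̲}`)
  obtain ⟨x', hx', γ, hγ⟩ := h3 g x hx
  have hXu : MulAut.conj γ • M.toTemperedCurve.inertia x' ≤ M.GtpXu l :=
    conj_smul_le_of_le_normal (h2 x' hx') γ
  have hA : (MulAut.conj g • (M.toTemperedCurve.inertia x).map M.inclX) ⊓ (M.GtpXu l).map M.inclX =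
      (MulAut.conj γ • M.toTemperedCurve.inertia x').map M.inclX := by
    rw [hγ]
    exact inf_eq_left.2 (Subgroup.map_mono hXu)
  -- pull the containment back through `ι` and `inclX`, elementwise: `γ I_{x'} γ⁻¹ ⊆ Π^tp_{X̲̲}`
  have hinj' : Function.Injective ι.toMonoidHom := hinj
  have hle₂ : MulAut.conj γ • M.toTemperedCurve.inertia x' ≤ C.Huu := by
    intro s hs
    have hsA : M.inclX s ∈ (MulAut.conj g • (M.toTemperedCurve.inertia x).map M.inclX) ⊓ (M.GtpXu l).map M.inclX := by
      rw [hA]; exact ⟨s, hs, rfl⟩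
    -- the element `t · ι(inclX s) · t⁻¹ = ι(inclX (t₀ s t₀⁻¹))` of the member lies in `Π_v = ι(inclX Π^tp_{X̲̲})`
    have hy : MulAut.conj (ι.toMonoidHom (M.inclX t₀)) • ι.toMonoidHom (M.inclX s) ∈
        (ofCoverModel e C μ hC hS hl hp2 hpl hζ hη ι hι hinj Φ hΦ hΦK hZ hN T).piV :=
      hle (Subgroup.smul_mem_pointwise_smul _ _ _ ⟨M.inclX s, hsA, rfl⟩)
    rw [piV_ofCoverModel] at hy
    obtain ⟨_, ⟨u, hu, rfl⟩, hEq⟩ := hy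
    have hEq' : ι.toMonoidHom (M.inclX u) = ι.toMonoidHom (M.inclX (t₀ * s * t₀⁻¹)) := by
      rw [hEq, MulAut.smul_def, MulAut.conj_apply, map_mul, map_mul, map_inv, map_mul, map_mul, map_inv]
    have hu' : u = t₀ * s * t₀⁻¹ := M.injective_inclX (hinj' hEq')
    exact mem_Huu_of_conj_mem C hN ht₀ (hu' ▸ hu)
  -- `θ`: `Δ_Θ = toTheta(γ I_{x'} γ⁻¹) ⊆ toTheta(Π^tp_{X̲̲}) ∩ Δ_Θ = l·Δ_Θ`
  have hθ : (MulAut.conj γ • M.toTemperedCurve.inertia x').map M.toThetaSetting.toTheta = M.toThetaSetting.DeltaTheta :=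
    M.toThetaSetting.map_toTheta_conj_eq_deltaTheta (h1 x' hx') γ
  have hle₃ : M.toThetaSetting.DeltaTheta ≤ M.toThetaSetting.lDeltaTheta l := by
    rw [← C.map_toTheta_Huu]
    exact le_inf (hθ ▸ Subgroup.map_mono hle₂) le_rfl
  exact h4 (le_antisymm (M.toThetaSetting.lDeltaTheta_le l) hle₃)

/-! ### 2. The level-`Π_v` family of a containment-keyed datum is EMPTY; statements over it are vacuous -/

include hN in
/-- **The level-`Π_v` family of a CONTAINMENT-keyed cuspidal datum is EMPTY** (kernel form of the faithfulness note): for every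
`Cu : CuspidalInertiaData (ofCoverModel …)` with abc-iut-w5-d132's characterisation (p430433, VERBATIM as `hchar`: at every level
`Π_□`, «`J ≤ Π_□ ∧ J = t · ι((g · inclX I_x · g⁻¹) ∩ inclX Π^tp_{X̲}) · t⁻¹`»), NO subgroup of `Π̂^cor_v` is a cuspidal inertia group of
`Π_v` for `Cu`, granted (h1)–(h4) of `not_cuspFamily_le_piV_ofCoverModel`. [claim: Mochizuki2012, status: disputed] (IUTchII §2 Def 2.3 (ii), kurims p.68) -/
theorem isEmpty_cuspidalInertia_piV_of_containment
    (Cu : CuspidalInertiaData (ofCoverModel e C μ hC hS hl hp2 hpl hζ hη ι hι hinj Φ hΦ hΦK hZ hN T))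
    (hchar : ∀ Q' J : Subgroup (ofCoverModel e C μ hC hS hl hp2 hpl hζ hη ι hι hinj Φ hΦ hΦK hZ hN T).Corhat,
      Cu.IsCuspidalInertia Q' J ↔ J ≤ Q' ∧ ∃ i : {x : M.Pt // M.IsCusp x} × M.GtpC,
        ∃ t ∈ (ofCoverModel e C μ hC hS hl hp2 hpl hζ hη ι hι hinj Φ hΦ hΦK hZ hN T).piPM,
          J = MulAut.conj t •
            (((MulAut.conj i.2 • (M.toTemperedCurve.inertia i.1.1).map M.inclX) ⊓ (M.GtpXu l).map M.inclX).map
              ι.toMonoidHom :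
              Subgroup (ofCoverModel e C μ hC hS hl hp2 hpl hζ hη ι hι hinj Φ hΦ hΦK hZ hN T).Corhat))
    (h1 : ∀ x : M.Pt, M.IsCusp x →
      (M.toTemperedCurve.inertia x).map M.toThetaSetting.toTheta = M.toThetaSetting.DeltaTheta)
    (h2 : ∀ x : M.Pt, M.IsCusp x → M.toTemperedCurve.inertia x ≤ M.GtpXu l)
    (h3 : ∀ (g : M.GtpC) (x : M.Pt), M.IsCusp x → ∃ x' : M.Pt, M.IsCusp x' ∧ ∃ γ : M.PiTemp,
      MulAut.conj g • (M.toTemperedCurve.inertia x).map M.inclX =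
        (MulAut.conj γ • M.toTemperedCurve.inertia x').map M.inclX)
    (h4 : M.toThetaSetting.lDeltaTheta l ≠ M.toThetaSetting.DeltaTheta) :
    IsEmpty {J // Cu.IsCuspidalInertia (ofCoverModel e C μ hC hS hl hp2 hpl hζ hη ι hι hinj Φ hΦ hΦK hZ hN T).piV J} := by
  refine ⟨fun ⟨J, hJ⟩ => ?_⟩
  obtain ⟨hle, ⟨⟨x, hx⟩, g⟩, t, ht, rfl⟩ := (hchar _ _).1 hJ
  exact not_cuspFamily_le_piV_ofCoverModel e C μ hC hS hl hp2 hpl hζ hη ι hι hinj Φ hΦ hΦK hZ hN T h1 h2 h3 h4 hx g ht hle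

include hN in
/-- **Vacuity**: over a containment-keyed datum, EVERY statement «`∀ J`, `J` a cuspidal inertia group of `Π_v` `→ P J`» holds — for
want of instances, not by content (granted (h1)–(h4)). A second reader's tool: a file keyed this way at the level `Π_v` proves
nothing about print's cuspidal inertia groups `I ∩ Π_v = I^l` of `Π_v` unless its proof never uses `J ≤ Π_v`.
[claim: Mochizuki2012, status: disputed] (IUTchII §2 Def 2.3 (ii), kurims p.68) -/
theorem forall_cuspidalInertia_piV_of_containment
    (Cu : CuspidalInertiaData (ofCoverModel e C μ hC hS hl hp2 hpl hζ hη ι hι hinj Φ hΦ hΦK hZ hN T))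
    (hchar : ∀ Q' J : Subgroup (ofCoverModel e C μ hC hS hl hp2 hpl hζ hη ι hι hinj Φ hΦ hΦK hZ hN T).Corhat,
      Cu.IsCuspidalInertia Q' J ↔ J ≤ Q' ∧ ∃ i : {x : M.Pt // M.IsCusp x} × M.GtpC,
        ∃ t ∈ (ofCoverModel e C μ hC hS hl hp2 hpl hζ hη ι hι hinj Φ hΦ hΦK hZ hN T).piPM,
          J = MulAut.conj t •
            (((MulAut.conj i.2 • (M.toTemperedCurve.inertia i.1.1).map M.inclX) ⊓ (M.GtpXu l).map M.inclX).map
              ι.toMonoidHom :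
              Subgroup (ofCoverModel e C μ hC hS hl hp2 hpl hζ hη ι hι hinj Φ hΦ hΦK hZ hN T).Corhat))
    (h1 : ∀ x : M.Pt, M.IsCusp x →
      (M.toTemperedCurve.inertia x).map M.toThetaSetting.toTheta = M.toThetaSetting.DeltaTheta)
    (h2 : ∀ x : M.Pt, M.IsCusp x → M.toTemperedCurve.inertia x ≤ M.GtpXu l)
    (h3 : ∀ (g : M.GtpC) (x : M.Pt), M.IsCusp x → ∃ x' : M.Pt, M.IsCusp x' ∧ ∃ γ : M.PiTemp,
      MulAut.conj g • (M.toTemperedCurve.inertia x).map M.inclX =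
        (MulAut.conj γ • M.toTemperedCurve.inertia x').map M.inclX)
    (h4 : M.toThetaSetting.lDeltaTheta l ≠ M.toThetaSetting.DeltaTheta)
    (Pr : Subgroup (ofCoverModel e C μ hC hS hl hp2 hpl hζ hη ι hι hinj Φ hΦ hΦK hZ hN T).Corhat → Prop) :
    ∀ J, Cu.IsCuspidalInertia (ofCoverModel e C μ hC hS hl hp2 hpl hζ hη ι hι hinj Φ hΦ hΦK hZ hN T).piV J → Pr J := by
  intro J hJ
  exact ((isEmpty_cuspidalInertia_piV_of_containment e C μ hC hS hl hp2 hpl hζ hη ι hι hinj Φ hΦ hΦK hZ hN T Cu hchar h1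
    h2 h3 h4).false ⟨J, hJ⟩).elim

/-! ### 3. … and the GAP row's shape for Cor. 2.5 (i) FAILS for such a datum -/

/-- **IUTchII:Cor2.5(i)'s GAP-row shape FAILS over a containment-keyed datum at the genuine tower** (`P := Π_v = Pi C`): for the
genuine Prop. 1.4 output `D := etaleThetaDataOfSetting' …` over `S := BadPlaceSetting.ofUnderline`, any `T`, and every `Cu` with
abc-iut-w5-d132's characterisation, the shape `(top).map ε = (bot).map ε ⊔ ⨆ (J cuspidal in Π_v), J` is FALSE (granted (h1)–(h4) and
`l·Δ_Θ ≠ 1`) — by §2 and p440613's `not_hgen_frame_of_isEmpty` — whereas over the intersection-keyed datum of p440613 §2/§3 it HOLDS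
(`exists_cuspidalInertiaData_hgen_ofPiCHat_of_commutatorAxis`). The datum matters; vacuously-true ≠ covered.
[claim: Mochizuki2012, status: disputed] (IUTchII §2 Cor 2.5 (i), kurims p.71) -/
theorem not_hgen_frame_ofCoverModel_of_containment
    {ι : M.GtpC →ₜ* Q} {hι : IsProfiniteCompletion ι} {hinj : Function.Injective ι}
    {Φ : Q →* GQp p} {hΦ : ∀ g : M.GtpC, Φ (ι g) = e.augC g} {hΦK : Φ.range = M.GK}
    (T : TemperedCoverings (BadPlaceSetting.ofUnderline C μ hC hS hl hp2 hpl hζ hη) (EtaleThetaDataOfSetting.Pi C))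
    (Cu : CuspidalInertiaData (ofCoverModel e C μ hC hS hl hp2 hpl hζ hη ι hι hinj Φ hΦ hΦK hZ hN T))
    (hchar : ∀ Q' J : Subgroup (ofCoverModel e C μ hC hS hl hp2 hpl hζ hη ι hι hinj Φ hΦ hΦK hZ hN T).Corhat,
      Cu.IsCuspidalInertia Q' J ↔ J ≤ Q' ∧ ∃ i : {x : M.Pt // M.IsCusp x} × M.GtpC,
        ∃ t ∈ (ofCoverModel e C μ hC hS hl hp2 hpl hζ hη ι hι hinj Φ hΦ hΦK hZ hN T).piPM,
          J = MulAut.conj t •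
            (((MulAut.conj i.2 • (M.toTemperedCurve.inertia i.1.1).map M.inclX) ⊓ (M.GtpXu l).map M.inclX).map
              ι.toMonoidHom :
              Subgroup (ofCoverModel e C μ hC hS hl hp2 hpl hζ hη ι hι hinj Φ hΦ hΦK hZ hN T).Corhat))
    (h1 : ∀ x : M.Pt, M.IsCusp x →
      (M.toTemperedCurve.inertia x).map M.toThetaSetting.toTheta = M.toThetaSetting.DeltaTheta)
    (h2 : ∀ x : M.Pt, M.IsCusp x → M.toTemperedCurve.inertia x ≤ M.GtpXu l)
    (h3 : ∀ (g : M.GtpC) (x : M.Pt), M.IsCusp x → ∃ x' : M.Pt, M.IsCusp x' ∧ ∃ γ : M.PiTemp,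
      MulAut.conj g • (M.toTemperedCurve.inertia x).map M.inclX =
        (MulAut.conj γ • M.toTemperedCurve.inertia x').map M.inclX)
    (h4 : M.toThetaSetting.lDeltaTheta l ≠ M.toThetaSetting.DeltaTheta)
    (hchr : EtaleThetaDataOfSetting.PiYddCharacteristic C)
    (eS : (EtaleThetaDataOfSetting.Pi C) ≃ₜ* (BadPlaceSetting.ofUnderline C μ hC hS hl hp2 hpl hζ hη).PiX)
    (hl' : (BadPlaceSetting.ofUnderline C μ hC hS hl hp2 hpl hζ hη).l = l)
    (hne : M.toThetaSetting.lDeltaTheta l ≠ ⊥) :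
    ¬ ((etaleThetaDataOfSetting' C hC hS hchr
              (BadPlaceSetting.ofUnderline C μ hC hS hl hp2 hpl hζ hη).toThetaSetting eS hl').lDeltaTheta.top).map
          ((ofCoverModel e C μ hC hS hl hp2 hpl hζ hη ι hι hinj Φ hΦ hΦK hZ hN T).emb.comp T.incl) =
        ((etaleThetaDataOfSetting' C hC hS hchr
                (BadPlaceSetting.ofUnderline C μ hC hS hl hp2 hpl hζ hη).toThetaSetting eS hl').lDeltaTheta.bot).map
            ((ofCoverModel e C μ hC hS hl hp2 hpl hζ hη ι hι hinj Φ hΦ hΦK hZ hN T).emb.comp T.incl) ⊔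
          ⨆ J : {J // Cu.IsCuspidalInertia (ofCoverModel e C μ hC hS hl hp2 hpl hζ hη ι hι hinj Φ hΦ hΦK hZ hN T).piV J},
            (J : Subgroup (ofCoverModel e C μ hC hS hl hp2 hpl hζ hη ι hι hinj Φ hΦ hΦK hZ hN T).Corhat) := by
  haveI := isEmpty_cuspidalInertia_piV_of_containment e C μ hC hS hl hp2 hpl hζ hη ι hι hinj Φ hΦ hΦK hZ hN T Cu hchar
    h1 h2 h3 h4
  exact EtaleThetaDataOfSetting.not_hgen_frame_of_isEmpty C T _ Cu hC hS hchr eS hl' hne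

end PlusMinusTower

end Literature.IUT.HodgeArakelov

end
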